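import Summits.ValiantsHypothesis.ValiantsHypothesis.Theses.BarrierLever
import Summits.ValiantsHypothesis.ValiantsHypothesis.Theorems.BarrierLeverKFoldDetNoGo
import Summits.ValiantsHypothesis.ValiantsHypothesis.Theorems.BarrierLeverPartitionMinorsHitByVPOfLowerSets
import Literature.Computability.AlgebraicComplexity.DetInVP

/-!
# Route BarrierLever — item `PartitionMinorsHitByVP` (stmt-ValiantsHypothesis-19717):
# the `K`-FOLD DETERMINANTAL DOOR

Helper file (`--supports stmt-ValiantsHypothesis-19717`; cell valiant-natproofs, rung V4, 𝒟-side door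
(c); prover seat val-np-p6 gen 7). Definition-free. Closes NO item. Positive side of
`…KFoldDetNoGo` / `…KFoldDetCapacityBound`.

The `K`-fold determinantal witness of a table `G ∈ ℂ^{N×N}` and a labelling `π : Fin N → Fin (h+h)` is
`f_{G,π} = rename π (det(1 + diag(X)·G)) = det[δ_{ij} + X_{π i} G_{ij}]_{i,j<N}`; its partition coefficients
are the `K`-fold principal-minor sums `Σ_{R : π(R) = U ⊔ W̄ bijectively} det G[R]`
(`KFoldDet.coeff_kfoldWitness`).

* `kfoldWitness_eq_det`, `complexity_kfoldWitness_le` — `f_{G,π}` is an `N × N` determinant of entries of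
  size `≤ 2`, so `L(f_{G,π}) ≤ 8(N+1)⁷ + 2N²` (Berkowitz, Literature `complexity_detPoly_le`).
* **`partitionMinor_hit_of_kfoldDet`** (THE DOOR) — if `N ≤ (2h)^c` (`h ≥ 4`) and the `K`-fold layout
  matrix of `(G, π)` on the layout `(u, w)` is nonsingular, the layout is hit in
  `SmallCircuits ℂ (h+h) (7c + 9)` (by the degree-`2h` truncation of `f_{G,π}`,
  `AdditiveDoor.truncation_spec`).
* `partitionMinorsHitByVP_of_kfoldDet` — item 19717 modulo «KC»: eventually in `h`, every injective layout
  has a nonsingular `K`-fold layout matrix for some table of size `N ≤ (2h)^c` (hypothesis inline; by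
  `…KFoldDetNoGo` such tables need a variable of multiplicity `≳ √h / log h`; the natural candidate is
  `N = 2h·K`, `K = h`: every variable on `h` diagonal slots).

WHAT THIS IS NOT: «KC» is a conjecture (census kit j292677: the 2-fold template clears every layout that
kills the 1-fold one up to `h = 31` and all lower-set pairs at `h ≤ 5`); nothing on crux
stmt-ValiantsHypothesis-14610 or `VP ≠ VNP`.
-/

set_option linter.dupNamespace false

open Matrix Finset MvPolynomial

namespace Summit.ValiantsHypothesis.ValiantsHypothesis.Theorems.BarrierLever.KFoldDet

open Literature.Barriers.ValiantsHypothesis Literature.Computability.AlgebraicComplexity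
open Summit.ValiantsHypothesis.ValiantsHypothesis.Theorems.BarrierLever.AdditiveDoor
  (truncation_spec degree_partitionExpo_le)
open Summit.ValiantsHypothesis.ValiantsHypothesis.Theorems.BarrierLever.DownCompression (size_le_pow)

noncomputable section

variable {h : ℕ}

/-! ## 1. The witness as an explicit determinant, and its size -/

/-- `rename π det(1 + diag X · G) = det[δ_{ij} + X_{π i}·G_{ij}]`. -/
theorem kfoldWitness_eq_det {N : ℕ} (G : Matrix (Fin N) (Fin N) ℂ) (π : Fin N → Fin (h + h)) :
    rename π ((1 + Matrix.diagonal (fun i : Fin N => (X i : MvPolynomial (Fin N) ℂ)) *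
        G.map MvPolynomial.C).det) =
      (Matrix.of fun i j : Fin N => (C (if i = j then (1 : ℂ) else 0) +
        X (π i) * C (G i j) : MvPolynomial (Fin (h + h)) ℂ)).det := by
  rw [AlgHom.map_det, AlgHom.mapMatrix_apply]
  congr 1
  ext i j
  rw [Matrix.map_apply, Matrix.of_apply, Matrix.add_apply, Matrix.diagonal_mul, Matrix.map_apply,
    Matrix.one_apply, map_add, map_mul, rename_X, rename_C]
  by_cases hij : i = j
  · subst hij; simp
  · simp [hij]

/-- The explicit determinant is a substitution instance of `DET_N`. -/
theorem kfoldDet_eq_aeval {N : ℕ} (G : Matrix (Fin N) (Fin N) ℂ) (π : Fin N → Fin (h + h)) :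
    (Matrix.of fun i j : Fin N => (C (if i = j then (1 : ℂ) else 0) +
        X (π i) * C (G i j) : MvPolynomial (Fin (h + h)) ℂ)).det =
      aeval (fun q : Fin N × Fin N => (C (if q.1 = q.2 then (1 : ℂ) else 0) +
        X (π q.1) * C (G q.1 q.2) : MvPolynomial (Fin (h + h)) ℂ)) (detPoly (Fin N) ℂ) := by
  rw [detPoly, AlgHom.map_det, AlgHom.mapMatrix_apply]
  congr 1
  ext i j
  simp [Matrix.mvPolynomialX_apply]

/-- **Size of the `K`-fold witness**: `≤ 8(N+1)⁷ + 2N²`. -/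
theorem complexity_kfoldWitness_le {N : ℕ} (G : Matrix (Fin N) (Fin N) ℂ) (π : Fin N → Fin (h + h)) :
    complexity (rename π ((1 + Matrix.diagonal (fun i : Fin N => (X i : MvPolynomial (Fin N) ℂ)) *
        G.map MvPolynomial.C).det)) ≤ 8 * (N + 1) ^ 7 + N * N * 2 := by
  rw [kfoldWitness_eq_det, kfoldDet_eq_aeval]
  refine (complexity_aeval_le _ _).trans (Nat.add_le_add (complexity_detPoly_le ℂ N) ?_)
  have hent : ∀ q : Fin N × Fin N, complexity (C (if q.1 = q.2 then (1 : ℂ) else 0) +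
      X (π q.1) * C (G q.1 q.2) : MvPolynomial (Fin (h + h)) ℂ) ≤ 2 := by
    intro q
    calc complexity (C (if q.1 = q.2 then (1 : ℂ) else 0) + X (π q.1) * C (G q.1 q.2) :
          MvPolynomial (Fin (h + h)) ℂ)
        ≤ complexity (C (if q.1 = q.2 then (1 : ℂ) else 0) : MvPolynomial (Fin (h + h)) ℂ) +
            complexity (X (π q.1) * C (G q.1 q.2) : MvPolynomial (Fin (h + h)) ℂ) + 1 :=
          complexity_add_le_holds _ _
      _ ≤ 0 + (complexity (X (π q.1) : MvPolynomial (Fin (h + h)) ℂ) +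
            complexity (C (G q.1 q.2) : MvPolynomial (Fin (h + h)) ℂ) + 1) + 1 := by
          gcongr
          · exact (complexity_C_holds _).le
          · exact complexity_mul_le_holds _ _
      _ = 2 := by rw [complexity_X_holds, complexity_C_holds]
  calc ∑ q : Fin N × Fin N, complexity (C (if q.1 = q.2 then (1 : ℂ) else 0) +
          X (π q.1) * C (G q.1 q.2) : MvPolynomial (Fin (h + h)) ℂ)
      ≤ ∑ _q : Fin N × Fin N, 2 := Finset.sum_le_sum fun q _ => hent q
    _ = N * N * 2 := by simp [Finset.card_univ]

/-- Size bookkeeping: `N ≤ (2h)^c`, `h ≥ 4` ⇒ `8(N+1)⁷ + 2N² ≤ (2h)^{7c+5}`. -/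
theorem kfold_size_le {N c : ℕ} (hh : 4 ≤ h) (hN : N ≤ (h + h) ^ c) :
    8 * (N + 1) ^ 7 + N * N * 2 ≤ (h + h) ^ (7 * c + 5) := by
  set Xc := (h + h) ^ c with hXc
  have hX1 : 1 ≤ Xc := Nat.one_le_pow _ _ (by omega)
  have hN1 : N + 1 ≤ 2 * Xc := by omega
  have h7 : (N + 1) ^ 7 ≤ (2 * Xc) ^ 7 := Nat.pow_le_pow_left hN1 7
  have hNN : N * N ≤ Xc ^ 7 := by
    calc N * N ≤ Xc * Xc := Nat.mul_le_mul hN hN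
      _ = Xc ^ 2 := by ring
      _ ≤ Xc ^ 7 := Nat.pow_le_pow_right hX1 (by norm_num)
  have hbase : 1026 ≤ (h + h) ^ 5 := by
    calc 1026 ≤ 8 ^ 5 := by norm_num
      _ ≤ (h + h) ^ 5 := Nat.pow_le_pow_left (by omega) 5
  calc 8 * (N + 1) ^ 7 + N * N * 2 ≤ 8 * (2 * Xc) ^ 7 + Xc ^ 7 * 2 := by gcongr
    _ = 1026 * Xc ^ 7 := by ring
    _ ≤ (h + h) ^ 5 * Xc ^ 7 := Nat.mul_le_mul_right _ hbase
    _ = (h + h) ^ (7 * c + 5) := by rw [hXc, ← pow_mul, ← pow_add]; ring_nf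

/-! ## 2. The door -/

/-- **THE `K`-FOLD DETERMINANTAL DOOR.** If `N ≤ (2h)^c` (`h ≥ 4`) and the `K`-fold principal-minor
layout matrix of `(G, π)` on `(u, w)` is nonsingular, the layout is hit in `SmallCircuits ℂ (h+h) (7c+9)`. -/
theorem partitionMinor_hit_of_kfoldDet (c : ℕ) (hh : 4 ≤ h) {N r : ℕ} (hN : N ≤ (h + h) ^ c)
    (G : Matrix (Fin N) (Fin N) ℂ) (π : Fin N → Fin (h + h)) (u w : Fin r → Finset (Fin h))
    (hdet : (Matrix.of fun i j : Fin r =>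
      ∑ R ∈ (Finset.univ : Finset (Fin N)).powerset.filter
        (fun R => R.image π = (u i).map (Fin.castAddEmb h) ∪ (w j).map (Fin.natAddEmb h) ∧
          R.card = ((u i).map (Fin.castAddEmb h) ∪ (w j).map (Fin.natAddEmb h)).card),
        (G.submatrix (Subtype.val : ↥R → Fin N) (Subtype.val : ↥R → Fin N)).det).det ≠ 0) :
    ∃ f ∈ SmallCircuits ℂ (h + h) (7 * c + 9),
      (Matrix.of fun i j : Fin r => MvPolynomial.coeff
        (∑ a ∈ u i, Finsupp.single (Fin.castAdd h a) 1 +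
          ∑ c ∈ w j, Finsupp.single (Fin.natAdd h c) 1) f).det ≠ 0 := by
  set g := rename π ((1 + Matrix.diagonal (fun i : Fin N => (X i : MvPolynomial (Fin N) ℂ)) *
        G.map MvPolynomial.C).det) with hg
  have hgs : complexity g ≤ (h + h) ^ (7 * c + 5) :=
    (complexity_kfoldWitness_le G π).trans (kfold_size_le hh hN)
  obtain ⟨hdeg, hcoeff, hsize⟩ := truncation_spec g (h + h)
  refine ⟨∑ k ∈ Finset.range (h + h + 1), homogeneousComponent k g, ⟨hdeg, ?_⟩, ?_⟩
  · calc complexity (∑ k ∈ Finset.range (h + h + 1), homogeneousComponent k g)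
        ≤ (h + h + 2) ^ 2 * complexity g + (h + h + 1) := hsize
      _ ≤ (h + h + 2) ^ 2 * ((h + h) ^ (7 * c + 5) + 6 * h) + (h + h + 1) := by
          gcongr; exact hgs.trans (Nat.le_add_right _ _)
      _ ≤ (h + h) ^ (7 * c + 5 + 4) := size_le_pow h (7 * c + 5) hh
      _ = (h + h) ^ (7 * c + 9) := by ring_nf
  · have hmat : (Matrix.of fun i j : Fin r => MvPolynomial.coeff
        (∑ a ∈ u i, Finsupp.single (Fin.castAdd h a) 1 +
          ∑ c ∈ w j, Finsupp.single (Fin.natAdd h c) 1)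
        (∑ k ∈ Finset.range (h + h + 1), homogeneousComponent k g)) =
        Matrix.of fun i j : Fin r =>
          ∑ R ∈ (Finset.univ : Finset (Fin N)).powerset.filter
            (fun R => R.image π = (u i).map (Fin.castAddEmb h) ∪ (w j).map (Fin.natAddEmb h) ∧
              R.card = ((u i).map (Fin.castAddEmb h) ∪ (w j).map (Fin.natAddEmb h)).card),
            (G.submatrix (Subtype.val : ↥R → Fin N) (Subtype.val : ↥R → Fin N)).det := by
      ext i j
      rw [Matrix.of_apply, Matrix.of_apply, hcoeff _ (degree_partitionExpo_le _ _), hg,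
        coeff_kfoldWitness]
    rw [hmat]
    exact hdet

/-- **Item 19717 modulo «KC»** (the `K`-fold determinantal conjecture, stated inline): if, eventually in
`h`, every injective layout has a nonsingular `K`-fold layout matrix for some table of size `N ≤ (2h)^c`
and some labelling, then `PartitionMinorsHitByVP` (with `b = 7c + 9`). -/
theorem partitionMinorsHitByVP_of_kfoldDet (c h₀ : ℕ)
    (H : ∀ h : ℕ, h₀ ≤ h → ∀ (r : ℕ) (u w : Fin r → Finset (Fin h)),
      Function.Injective u → Function.Injective w →
        ∃ (N : ℕ) (_ : N ≤ (h + h) ^ c) (G : Matrix (Fin N) (Fin N) ℂ) (π : Fin N → Fin (h + h)),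
          (Matrix.of fun i j : Fin r =>
            ∑ R ∈ (Finset.univ : Finset (Fin N)).powerset.filter
              (fun R => R.image π = (u i).map (Fin.castAddEmb h) ∪ (w j).map (Fin.natAddEmb h) ∧
                R.card = ((u i).map (Fin.castAddEmb h) ∪ (w j).map (Fin.natAddEmb h)).card),
              (G.submatrix (Subtype.val : ↥R → Fin N) (Subtype.val : ↥R → Fin N)).det).det ≠ 0) :
    Summit.ValiantsHypothesis.ValiantsHypothesis.Theses.BarrierLever.PartitionMinorsHitByVP := by
  refine ⟨7 * c + 9, max h₀ 4, fun h hh r u w hu hw => ?_⟩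
  have hh₀ : h₀ ≤ h := le_trans (le_max_left _ _) hh
  have hh4 : 4 ≤ h := le_trans (le_max_right _ _) hh
  obtain ⟨N, hN, G, π, hdet⟩ := H h hh₀ r u w hu hw
  exact partitionMinor_hit_of_kfoldDet c hh4 hN G π u w hdet

end

end Summit.ValiantsHypothesis.ValiantsHypothesis.Theorems.BarrierLever.KFoldDet
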